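import Literature.NumberTheory.EllipticCurves.Milne1972.WeilRestrictionQuadraticBSDQuotientAnyModel
import Literature.NumberTheory.EllipticCurves.Milne1972.WeilRestrictionQuadraticBSDQuotientOfAnyModelProofs
import Literature.NumberTheory.EllipticCurves.ComplexPeriodProofs
import Literature.NumberTheory.EllipticCurves.RegulatorProofs
import Literature.NumberTheory.EllipticCurves.BSDSelmerParityDokchitserProp417Proofs
import Literature.NumberTheory.EllipticCurves.BSDQuadraticDescent
import Literature.NumberTheory.EllipticCurves.BSDInvariantsProofs
import Literature.NumberTheory.EllipticCurves.BSDSelmerPConverseYanZhuKolyvaginSystemProofs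
import Literature.NumberTheory.EllipticCurves.HeegnerPointsOfConductorOneGaloisConjProofs
import Literature.NumberTheory.EllipticCurves.BSDRootNumberSmallConductorProofs
import Literature.NumberTheory.EllipticCurves.ShaRestriction
import Literature.NumberTheory.QuadraticFields.SquareRootGenerator
import HarnessLib

/-!
# Route `GenusKolyvaginAtTwo`, LINE 18 v3 / LINE 19 v3 (L_T `PowDvdShaCardAtTwoRT` stmt-BirchSwinnertonDyer-23242,
# L⁺_T `PowDvdShaCardAtTwoPosT` stmt-23379), registered stub `stub_milneDefect` (3b″, «the Milne defect»):
# PROVED MODULO the named facts `kolyvagin` (finiteness of `Ш`) and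
# `Milne1972.bsdQuotient_baseChange_quadratic_anyModel` (route support item `MilneAnyModel`, stmt-24149)

Seat `bsd-line-gk2-p3` g16 (cell `bsd-f1-sign2`), `--supports stmt-BirchSwinnertonDyer-23242` (helper; closes
nothing — the stub is obtained behind two displayed PRINT antecedents, a CONDITIONAL result, D-0014).  THEOREMS
ONLY (no definition, no new named fact, no `sorry`); BSD is not proved by any of this.

The stub (pen `bsd-idea-1` g10, skeleton v3 of 2026-08-28T21:55Z, critic #179 sharpening «3b″ = Milne-exact
equality … print modulo finiteness»): on the genus frame, for a globally minimal model `Wd` of `E^{(d_K)}`,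
`g = #Ш(E/ℚ)[2^∞]`, `g' = #Ш(Wd/ℚ)[2^∞]`, `G = #Ш(E_K/K)[2^∞]` are positive and there is a rational `q ≠ 0`,
EQUAL to the ratio of Birch–Swinnerton-Dyer data `(Reg·Ω·C/#tors²)(E) · (Reg·Ω·C/#tors²)(Wd) / (Reg·Ω·C/#tors²)(E_K)`,
with `ord₂ G = ord₂ g + ord₂ g' + ord₂ q`.  Proof:
1. `P(1)` gives a non-torsion Heegner point in `E(K)`, so `Ш(E_K)` is finite (`kolyvagin`), hence `Ш(E/ℚ)`
   (`shaFinite_of_baseChange`) and `Ш(Wd/ℚ)` (`shaFinite_quadraticTwist_of_shaFinite_baseChange`, the twist becomes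
   isomorphic to `E` over `K`) are finite — the three positivity clauses.
2. Milne 1972 Thm. 1 in Dokchitser–Dokchitser's model-free form (`hMilne`, with `V = W.baseChange K`):
   `#Ш(E_K)·A(E_K) = BSD(E)·BSD(Wd) = #Ш(E)·A(E)·#Ш(Wd)·A(Wd)` where `A = Reg·Ω·C/#tors²` (for the globally
   minimal `ℚ`-models `Ω = bsdPeriod = realPeriodRat`, `C = modifiedTamagawaProduct = tamagawaProduct`).
3. `q := #Ш(E_K)/(#Ш(E)·#Ш(Wd)) ∈ ℚ_{>0}` equals `A(E)·A(Wd)/A(E_K)` (all `A > 0`: `regulator_pos'`, `bsdPeriod_pos'`,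
   `modifiedTamagawaProduct_pos`, `torsionOrder_pos_holds`), and `ord₂ q = ord₂ #Ш(E_K) − ord₂ #Ш(E) − ord₂ #Ш(Wd)`
   with `ord₂ #Ш = ord₂ #Ш[2^∞]` (`padicValNat_card_addPrimaryComponent`).

* `milneDefect_of_kolyvagin_of_milne` — the core, hypotheses by name, no `Δ`-sign.
* `stub_milneDefect_of_facts` / `stub_milneDefectPos_of_facts` — the LINE 18 / LINE 19 stub signatures VERBATIM behind
  `∀ N W K, kolyvagin N W K` and `Milne1972.bsdQuotient_baseChange_quadratic_anyModel`.

References: [Milne1972ArithmeticAV] §1 Thm. 1; [DokchitserDokchitserAnnals2010] §2.1; [Gross1991] Thm. 1.3;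
[Darmon2004] §3.9; [SilvermanAEC2009] X.5.4.
-/

set_option autoImplicit false
-- the Theorems namespace of this sub repeats the summit name by design (D-0017 nested layout)
set_option linter.dupNamespace false

noncomputable section

open scoped Classical

namespace Summit.BirchSwinnertonDyer.BirchSwinnertonDyer.Theorems.GenusExact.PlusDescent

open WeierstrassCurve NumberField Literature.NumberTheory.EllipticCurves
  Literature.NumberTheory.EllipticCurves.ModularForms Literature.NumberTheory.QuadraticFields

/-! ## §1 Finiteness of the three `Ш` from Kolyvagin -/

/-- **`Ш(E_K)`, `Ш(E/ℚ)` and `Ш(Wd/ℚ)` are finite** on the genus frame, modulo `kolyvagin`: the Heegner datum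
`P(1)` descends to a non-torsion Heegner point `P₀ ∈ E(K)` (`heegnerSystem_exists_isHeegnerPoint_map_eq_derivedPoint_one`),
Kolyvagin's theorem gives `Ш(E_K)` finite, finiteness descends to `ℚ` (`shaFinite_of_baseChange`) and passes to the
twist, isomorphic to `E` over `K` (`shaFinite_quadraticTwist_of_shaFinite_baseChange`, `d_K = c·q²`).
[cite: Gross1991, Thm. 1.3] [cite: Darmon2004, §3.9 (proof of Thm. 3.22)] [cite: SilvermanAEC2009, X.5.4] -/
theorem shaFinite_triple_of_kolyvagin
    (W : WeierstrassCurve ℚ) [W.IsElliptic] [W.IsGloballyMinimal] [NeZero (W.conductorNorm ℤ)]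
    (K : Type) [Field K] [NumberField K] (hKo : kolyvagin (W.conductorNorm ℤ) W K)
    (hK : IsImaginaryQuadratic K) (hH : SatisfiesHeegnerHypothesis (W.conductorNorm ℤ) K)
    {Dt : ModularParametrizationData W (W.conductorNorm ℤ)} {β : ℤ} {ι : K →+* ℂ}
    (d₁ : KolyvaginHeegnerData Dt β ι 1) (hy : ¬ IsOfFinAddOrder d₁.derivedPoint)
    (Wd : WeierstrassCurve ℚ) [Wd.IsElliptic]
    (hWd : ∃ C : WeierstrassCurve.VariableChange ℚ, C • W.quadraticTwist (NumberField.discr K : ℚ) = Wd) :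
    (W.baseChange K).ShaFinite ∧ W.ShaFinite ∧ Wd.ShaFinite := by
  haveI hEK : (W.baseChange K).IsElliptic := by rw [WeierstrassCurve.baseChange]; infer_instance
  have h2 : Module.finrank ℚ K = 2 := hK.1
  obtain ⟨P₀, hP₀, hP₀K⟩ := heegnerSystem_exists_isHeegnerPoint_map_eq_derivedPoint_one
    (heegnerPointOfConductor_one_galoisConj_holds (W.conductorNorm ℤ) W K) hK hH d₁
  have hPinf : ¬ IsOfFinAddOrder P₀ := by
    intro hfin
    apply hy
    rw [← hP₀K]
    exact (WeierstrassCurve.Affine.Point.map (W' := W)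
      (algebraMap K (ringClassField K ι 1)).toRatAlgHom).isOfFinAddOrder hfin
  obtain ⟨-, hShaK⟩ := hKo hK hH hP₀ hPinf
  have hShaW : W.ShaFinite := shaFinite_of_baseChange W K hShaK
  -- the twist: `K = ℚ(θ)`, `θ² = c`, `d_K = c q²`, `Wd ≅ W^{(c)}` over `ℚ`
  obtain ⟨θ, c, hθ, hc⟩ := Quadratic.exists_sq_eq_algebraMap (F := ℚ) (K := K) h2
  obtain ⟨q, hq, hd⟩ := NumberField.exists_discr_eq_mul_sq h2 hθ hc
  have hShac : (W.quadraticTwist c).ShaFinite := shaFinite_quadraticTwist_of_shaFinite_baseChange W K hθ hc hShaK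
  obtain ⟨C₁, hC₁⟩ := W.exists_variableChange_quadraticTwist_mul_sq c q hq
  rw [← hd] at hC₁
  obtain ⟨Cd, hCd⟩ := hWd
  have hShaWd : Wd.ShaFinite := by
    rw [← hCd, ← hC₁, ← mul_smul]
    exact (shaFinite_variableChange_iff_holds (W.quadraticTwist c) (Cd * C₁)).mpr hShac
  exact ⟨hShaK, hShaW, hShaWd⟩

/-! ## §2 The Milne defect, modulo `kolyvagin` and Milne 1972 -/

/-- **THE MILNE DEFECT (stub 3b″ of LINE 18/19 v3) modulo `kolyvagin` and
`Milne1972.bsdQuotient_baseChange_quadratic_anyModel`.**  `W/ℚ` globally minimal elliptic, `K` imaginary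
quadratic with Heegner `d_K`, `P(1)` of infinite order, `Wd` a globally minimal model of `E^{(d_K)}`.  Then
`#Ш(E/ℚ)[2^∞]`, `#Ш(Wd/ℚ)[2^∞]`, `#Ш(E_K/K)[2^∞]` are positive and, with
`A(X) = Reg(X)·Ω(X)·C(X)/#X_tors²` (`regulator`, `bsdPeriod`, `modifiedTamagawaProduct`, `torsionOrder`), the rational
`q = #Ш(E_K)/(#Ш(E)·#Ш(Wd)) ≠ 0` satisfies `q = A(E)·A(Wd)/A(E_K)` (Milne 1972 Thm. 1 / Dokchitser–Dokchitser 2010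
§2.1: `#Ш(E_K)·A(E_K) = BSD(E)·BSD(Wd)`; `bsdPeriod_eq_realPeriod_baseChange`,
`modifiedTamagawaProduct_eq_tamagawaProduct_of_isGloballyMinimal` identify `BSD = #Ш·A` over `ℚ`) and
`ord₂ #Ш(E_K)[2^∞] = ord₂ #Ш(E)[2^∞] + ord₂ #Ш(Wd)[2^∞] + ord₂ q`.  CONDITIONAL on the two named facts.
[cite: Milne1972ArithmeticAV, §1 Thm. 1] [cite: DokchitserDokchitserAnnals2010, §2.1 (statement 2.1, proof of Thm. 2.3)]
[cite: Gross1991, Thm. 1.3] -/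
theorem milneDefect_of_kolyvagin_of_milne
    (W : WeierstrassCurve ℚ) [W.IsElliptic] [W.IsGloballyMinimal] [NeZero (W.conductorNorm ℤ)]
    (K : Type) [Field K] [NumberField K] (hKo : kolyvagin (W.conductorNorm ℤ) W K)
    (hMilne : Milne1972.bsdQuotient_baseChange_quadratic_anyModel)
    (hK : IsImaginaryQuadratic K) (hH : SatisfiesHeegnerHypothesis (W.conductorNorm ℤ) K)
    {Dt : ModularParametrizationData W (W.conductorNorm ℤ)} {β : ℤ} {ι : K →+* ℂ}
    (d₁ : KolyvaginHeegnerData Dt β ι 1) (hy : ¬ IsOfFinAddOrder d₁.derivedPoint)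
    (Wd : WeierstrassCurve ℚ) [Wd.IsElliptic] [Wd.IsGloballyMinimal]
    (hWd : ∃ C : WeierstrassCurve.VariableChange ℚ, C • W.quadraticTwist (NumberField.discr K : ℚ) = Wd) :
    0 < Nat.card (AddCommGroup.primaryComponent W.sha 2) ∧
      0 < Nat.card (AddCommGroup.primaryComponent Wd.sha 2) ∧
      0 < Nat.card (AddCommGroup.primaryComponent (W.baseChange K).sha 2) ∧
      ∃ q : ℚ, q ≠ 0 ∧
        (q : ℝ) = (W.regulator * W.bsdPeriod * ((W.modifiedTamagawaProduct : ℚ) : ℝ) /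
              ((W.torsionOrder : ℕ) : ℝ) ^ 2) *
            (Wd.regulator * Wd.bsdPeriod * ((Wd.modifiedTamagawaProduct : ℚ) : ℝ) /
              ((Wd.torsionOrder : ℕ) : ℝ) ^ 2) /
            ((W.baseChange K).regulator * (W.baseChange K).bsdPeriod *
              (((W.baseChange K).modifiedTamagawaProduct : ℚ) : ℝ) /
                (((W.baseChange K).torsionOrder : ℕ) : ℝ) ^ 2) ∧
        (padicValNat 2 (Nat.card (AddCommGroup.primaryComponent (W.baseChange K).sha 2)) : ℤ) =
          (padicValNat 2 (Nat.card (AddCommGroup.primaryComponent W.sha 2)) : ℤ) +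
            (padicValNat 2 (Nat.card (AddCommGroup.primaryComponent Wd.sha 2)) : ℤ) + padicValRat 2 q := by
  haveI : Fact (Nat.Prime 2) := ⟨Nat.prime_two⟩
  haveI hEK : (W.baseChange K).IsElliptic := by rw [WeierstrassCurve.baseChange]; infer_instance
  have h2 : Module.finrank ℚ K = 2 := hK.1
  obtain ⟨hShaK, hShaW, hShaWd⟩ := shaFinite_triple_of_kolyvagin W K hKo hK hH d₁ hy Wd hWd
  haveI : Finite (W.baseChange K).sha := hShaK
  haveI : Finite W.sha := hShaW
  haveI : Finite Wd.sha := hShaWd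
  set V := W.baseChange K with hV
  -- positivity
  have hg : 0 < Nat.card (AddCommGroup.primaryComponent W.sha 2) := Nat.card_pos
  have hg' : 0 < Nat.card (AddCommGroup.primaryComponent Wd.sha 2) := Nat.card_pos
  have hG : 0 < Nat.card (AddCommGroup.primaryComponent V.sha 2) := Nat.card_pos
  refine ⟨hg, hg', hG, ?_⟩
  -- Milne 1972 on the model `V = W ⊗ K`
  obtain ⟨-, hM⟩ := hMilne W K h2 Wd hWd V ⟨1, one_smul _ _⟩ hShaW hShaWd
  -- the BSD data
  have hsW : 0 < W.shaOrder := shaOrder_pos W hShaW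
  have hsWd : 0 < Wd.shaOrder := shaOrder_pos Wd hShaWd
  have hsV : 0 < V.shaOrder := shaOrder_pos V hShaK
  have hRW : 0 < W.regulator := regulator_pos' W
  have hRWd : 0 < Wd.regulator := regulator_pos' Wd
  have hRV : 0 < V.regulator := regulator_pos' V
  have hΩW : 0 < W.bsdPeriod := bsdPeriod_pos' W
  have hΩWd : 0 < Wd.bsdPeriod := bsdPeriod_pos' Wd
  have hΩV : 0 < V.bsdPeriod := bsdPeriod_pos' V
  have hCW : (0 : ℝ) < ((W.modifiedTamagawaProduct : ℚ) : ℝ) := by exact_mod_cast W.modifiedTamagawaProduct_pos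
  have hCWd : (0 : ℝ) < ((Wd.modifiedTamagawaProduct : ℚ) : ℝ) := by exact_mod_cast Wd.modifiedTamagawaProduct_pos
  have hCV : (0 : ℝ) < ((V.modifiedTamagawaProduct : ℚ) : ℝ) := by exact_mod_cast V.modifiedTamagawaProduct_pos
  have htW : (0 : ℝ) < ((W.torsionOrder : ℕ) : ℝ) := by exact_mod_cast W.torsionOrder_pos_holds
  have htWd : (0 : ℝ) < ((Wd.torsionOrder : ℕ) : ℝ) := by exact_mod_cast Wd.torsionOrder_pos_holds
  have htV : (0 : ℝ) < ((V.torsionOrder : ℕ) : ℝ) := by exact_mod_cast V.torsionOrder_pos_holds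
  -- over `ℚ`: `bsdRHS = #Ш · Reg · bsdPeriod · modifiedTamagawaProduct / #tors²` for globally minimal models
  have hRHS : ∀ (X : WeierstrassCurve ℚ) [X.IsElliptic] [X.IsGloballyMinimal],
      X.bsdRHS = (X.shaOrder : ℝ) * (X.regulator * X.bsdPeriod * ((X.modifiedTamagawaProduct : ℚ) : ℝ) /
        ((X.torsionOrder : ℕ) : ℝ) ^ 2) := by
    intro X _ _
    rw [WeierstrassCurve.bsdRHS, X.modifiedTamagawaProduct_eq_tamagawaProduct_of_isGloballyMinimal,
      bsdPeriod_eq_realPeriod_baseChange, WeierstrassCurve.realPeriodRat]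
    push_cast
    ring
  rw [hRHS W, hRHS Wd] at hM
  -- the rational `q = #Ш(E_K)/(#Ш(E)·#Ш(Wd))`
  set A : ℝ := W.regulator * W.bsdPeriod * ((W.modifiedTamagawaProduct : ℚ) : ℝ) /
    ((W.torsionOrder : ℕ) : ℝ) ^ 2 with hA
  set Ad : ℝ := Wd.regulator * Wd.bsdPeriod * ((Wd.modifiedTamagawaProduct : ℚ) : ℝ) /
    ((Wd.torsionOrder : ℕ) : ℝ) ^ 2 with hAd
  set AV : ℝ := V.regulator * V.bsdPeriod * ((V.modifiedTamagawaProduct : ℚ) : ℝ) /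
    ((V.torsionOrder : ℕ) : ℝ) ^ 2 with hAV
  have hApos : 0 < A := by rw [hA]; positivity
  have hAdpos : 0 < Ad := by rw [hAd]; positivity
  have hAVpos : 0 < AV := by rw [hAV]; positivity
  have hM' : (V.shaOrder : ℝ) * AV = (W.shaOrder : ℝ) * A * ((Wd.shaOrder : ℝ) * Ad) := by
    rw [← hM, hAV]
    ring
  refine ⟨(V.shaOrder : ℚ) / ((W.shaOrder : ℚ) * (Wd.shaOrder : ℚ)), ?_, ?_, ?_⟩
  · have h1 : (V.shaOrder : ℚ) ≠ 0 := by exact_mod_cast hsV.ne'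
    have h2' : (W.shaOrder : ℚ) ≠ 0 := by exact_mod_cast hsW.ne'
    have h3 : (Wd.shaOrder : ℚ) ≠ 0 := by exact_mod_cast hsWd.ne'
    exact div_ne_zero h1 (mul_ne_zero h2' h3)
  · have h2' : (W.shaOrder : ℝ) ≠ 0 := by exact_mod_cast hsW.ne'
    have h3 : (Wd.shaOrder : ℝ) ≠ 0 := by exact_mod_cast hsWd.ne'
    push_cast
    rw [div_eq_div_iff (mul_ne_zero h2' h3) hAVpos.ne']
    linear_combination hM'
  · -- valuations
    have hvq : padicValRat 2 ((V.shaOrder : ℚ) / ((W.shaOrder : ℚ) * (Wd.shaOrder : ℚ))) =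
        (padicValNat 2 V.shaOrder : ℤ) - (padicValNat 2 W.shaOrder : ℤ) - (padicValNat 2 Wd.shaOrder : ℤ) := by
      have h1 : (V.shaOrder : ℚ) ≠ 0 := by exact_mod_cast hsV.ne'
      have h2' : (W.shaOrder : ℚ) ≠ 0 := by exact_mod_cast hsW.ne'
      have h3 : (Wd.shaOrder : ℚ) ≠ 0 := by exact_mod_cast hsWd.ne'
      rw [padicValRat.div h1 (mul_ne_zero h2' h3), padicValRat.mul h2' h3, padicValRat.of_nat, padicValRat.of_nat,
        padicValRat.of_nat]
      ring
    rw [hvq]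
    have eV : padicValNat 2 V.shaOrder = padicValNat 2 (Nat.card (AddCommGroup.primaryComponent V.sha 2)) := by
      unfold WeierstrassCurve.shaOrder; rw [padicValNat_card_addPrimaryComponent]
    have eW : padicValNat 2 W.shaOrder = padicValNat 2 (Nat.card (AddCommGroup.primaryComponent W.sha 2)) := by
      unfold WeierstrassCurve.shaOrder; rw [padicValNat_card_addPrimaryComponent]
    have eWd : padicValNat 2 Wd.shaOrder = padicValNat 2 (Nat.card (AddCommGroup.primaryComponent Wd.sha 2)) := by
      unfold WeierstrassCurve.shaOrder; rw [padicValNat_card_addPrimaryComponent]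
    rw [eV, eW, eWd]
    ring

/-! ## §3 The two registered stubs, modulo the named facts -/

/-- **LINE 18 v3 `stub_milneDefect` (L_T `PowDvdShaCardAtTwoRT`, stmt-BirchSwinnertonDyer-23242) MODULO `kolyvagin`
and `Milne1972.bsdQuotient_baseChange_quadratic_anyModel`**: the registered stub signature VERBATIM as conclusion,
the two named facts (universally closed) as antecedents; only `K` imaginary quadratic with Heegner `d_K`, `P(1)` of
infinite order and the globally minimal twin `Wd` are used (the `Δ`-sign, `¬CM`, odd Tamagawa, `ρ̄` onto, `M₀`, `n`
are idle).  CONDITIONAL (D-0014). [cite: Milne1972ArithmeticAV, §1 Thm. 1] [cite: Gross1991, Thm. 1.3] -/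
theorem stub_milneDefect_of_facts
    (hKo : ∀ (N : ℕ) [NeZero N] (W : WeierstrassCurve ℚ) (K : Type) [Field K] [NumberField K],
      kolyvagin N W K)
    (hMilne : Milne1972.bsdQuotient_baseChange_quadratic_anyModel) :
    ∀ (W : WeierstrassCurve ℚ) [W.IsElliptic] [W.IsGloballyMinimal] [NeZero (W.conductorNorm ℤ)], ¬ W.HasCM →
      Odd W.tamagawaProduct → W.Δ < 0 →
      ∀ (K : Type) [Field K] [NumberField K], Literature.NumberTheory.EllipticCurves.IsImaginaryQuadratic K →
      Odd (NumberField.discr K) → NumberField.discr K ≠ -3 →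
      Literature.NumberTheory.EllipticCurves.SatisfiesHeegnerHypothesis (W.conductorNorm ℤ) K →
      ¬ IsSquare ((NumberField.discr K : ℚ) * -|W.Δ|) →
      ¬ IsSquare ((NumberField.discr K : ℚ) * (-(2 * |W.Δ|))) → (∀ n : ℕ, 0 < n →
      W.HasSurjectiveModNGaloisRep ((2 : ℤ) ^ n)) →
      ∀ (Dt : Literature.NumberTheory.EllipticCurves.ModularForms.ModularParametrizationData W (W.conductorNorm ℤ)) (β : ℤ) (ι : K →+* ℂ) (d₁ : Literature.NumberTheory.EllipticCurves.KolyvaginHeegnerData Dt β ι 1), ¬ IsOfFinAddOrder d₁.derivedPoint →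
      ∀ (M₀ : ℕ),
        (∃ Q : (W.baseChange (Literature.NumberTheory.EllipticCurves.ringClassField K ι 1)).toAffine.Point,
        ((2 ^ M₀ : ℕ) : ℤ) • Q = d₁.derivedPoint) →
      (¬ ∃ Q : (W.baseChange (Literature.NumberTheory.EllipticCurves.ringClassField K ι 1)).toAffine.Point,
        ((2 ^ (M₀ + 1) : ℕ) : ℤ) • Q = d₁.derivedPoint) →
      ∀ (n : ℕ) (d : Literature.NumberTheory.EllipticCurves.KolyvaginHeegnerData Dt β ι n), Squarefree n →
      (∀ ℓ ∈ n.primeFactors,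
        Literature.NumberTheory.EllipticCurves.Zhang2014.IsKolyvaginPrime (W.conductorNorm ℤ) W K 2 ℓ) →
      (¬ ∃ Q : (W.baseChange (Literature.NumberTheory.EllipticCurves.ringClassField K ι n)).toAffine.Point,
        (2 : ℤ) • Q = d.derivedPoint) →
      ∀ (Wd : WeierstrassCurve ℚ) [Wd.IsElliptic] [Wd.IsGloballyMinimal],
        (∃ C : WeierstrassCurve.VariableChange ℚ, C • W.quadraticTwist (NumberField.discr K : ℚ) = Wd) →
      0 < Nat.card (AddCommGroup.primaryComponent W.sha 2) ∧
      0 < Nat.card (AddCommGroup.primaryComponent Wd.sha 2) ∧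
      0 < Nat.card (AddCommGroup.primaryComponent (W.baseChange K).sha 2) ∧ ∃ q : ℚ, q ≠ 0 ∧
      (q : ℝ) = (W.regulator * W.bsdPeriod * ((W.modifiedTamagawaProduct : ℚ) : ℝ) /
        ((W.torsionOrder : ℕ) : ℝ) ^ 2) * (Wd.regulator * Wd.bsdPeriod *
        ((Wd.modifiedTamagawaProduct : ℚ) : ℝ) / ((Wd.torsionOrder : ℕ) : ℝ) ^ 2) /
        ((W.baseChange K).regulator * (W.baseChange K).bsdPeriod *
        (((W.baseChange K).modifiedTamagawaProduct : ℚ) : ℝ) /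
        (((W.baseChange K).torsionOrder : ℕ) : ℝ) ^ 2) ∧
      (padicValNat 2 (Nat.card (AddCommGroup.primaryComponent (W.baseChange K).sha 2)) : ℤ) =
        (padicValNat 2 (Nat.card (AddCommGroup.primaryComponent W.sha 2)) : ℤ) + (padicValNat 2 (Nat.card (AddCommGroup.primaryComponent Wd.sha 2)) : ℤ) + padicValRat 2 q := by
  intro W _ _ _ _hcm _hT _hΔ K _ _ hK _hodd _h3 hH _hsq _hsq2 _hsurj Dt β ι d₁ hy _M₀ _hdiv _hndiv _n _d _hn
    _hKol _hprim Wd _ _ hWd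
  exact milneDefect_of_kolyvagin_of_milne W K (hKo _ W K) hMilne hK hH d₁ hy Wd hWd

/-- **LINE 19 v3 `stub_milneDefect` (L⁺_T `PowDvdShaCardAtTwoPosT`, stmt-BirchSwinnertonDyer-23379) MODULO `kolyvagin`
and `Milne1972.bsdQuotient_baseChange_quadratic_anyModel`**: the registered stub signature VERBATIM (`0 < W.Δ`; the
sign is idle) behind the two named facts.  CONDITIONAL (D-0014). [cite: Milne1972ArithmeticAV, §1 Thm. 1]
[cite: Gross1991, Thm. 1.3] -/
theorem stub_milneDefectPos_of_facts
    (hKo : ∀ (N : ℕ) [NeZero N] (W : WeierstrassCurve ℚ) (K : Type) [Field K] [NumberField K],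
      kolyvagin N W K)
    (hMilne : Milne1972.bsdQuotient_baseChange_quadratic_anyModel) :
    ∀ (W : WeierstrassCurve ℚ) [W.IsElliptic] [W.IsGloballyMinimal] [NeZero (W.conductorNorm ℤ)], ¬ W.HasCM →
      Odd W.tamagawaProduct → 0 < W.Δ →
      ∀ (K : Type) [Field K] [NumberField K], Literature.NumberTheory.EllipticCurves.IsImaginaryQuadratic K →
      Odd (NumberField.discr K) → NumberField.discr K ≠ -3 →
      Literature.NumberTheory.EllipticCurves.SatisfiesHeegnerHypothesis (W.conductorNorm ℤ) K →
      ¬ IsSquare ((NumberField.discr K : ℚ) * -|W.Δ|) →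
      ¬ IsSquare ((NumberField.discr K : ℚ) * (-(2 * |W.Δ|))) → (∀ n : ℕ, 0 < n →
      W.HasSurjectiveModNGaloisRep ((2 : ℤ) ^ n)) →
      ∀ (Dt : Literature.NumberTheory.EllipticCurves.ModularForms.ModularParametrizationData W (W.conductorNorm ℤ)) (β : ℤ) (ι : K →+* ℂ) (d₁ : Literature.NumberTheory.EllipticCurves.KolyvaginHeegnerData Dt β ι 1), ¬ IsOfFinAddOrder d₁.derivedPoint →
      ∀ (M₀ : ℕ),
        (∃ Q : (W.baseChange (Literature.NumberTheory.EllipticCurves.ringClassField K ι 1)).toAffine.Point,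
        ((2 ^ M₀ : ℕ) : ℤ) • Q = d₁.derivedPoint) →
      (¬ ∃ Q : (W.baseChange (Literature.NumberTheory.EllipticCurves.ringClassField K ι 1)).toAffine.Point,
        ((2 ^ (M₀ + 1) : ℕ) : ℤ) • Q = d₁.derivedPoint) →
      ∀ (n : ℕ) (d : Literature.NumberTheory.EllipticCurves.KolyvaginHeegnerData Dt β ι n), Squarefree n →
      (∀ ℓ ∈ n.primeFactors,
        Literature.NumberTheory.EllipticCurves.Zhang2014.IsKolyvaginPrime (W.conductorNorm ℤ) W K 2 ℓ) →
      (¬ ∃ Q : (W.baseChange (Literature.NumberTheory.EllipticCurves.ringClassField K ι n)).toAffine.Point,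
        (2 : ℤ) • Q = d.derivedPoint) →
      ∀ (Wd : WeierstrassCurve ℚ) [Wd.IsElliptic] [Wd.IsGloballyMinimal],
        (∃ C : WeierstrassCurve.VariableChange ℚ, C • W.quadraticTwist (NumberField.discr K : ℚ) = Wd) →
      0 < Nat.card (AddCommGroup.primaryComponent W.sha 2) ∧
      0 < Nat.card (AddCommGroup.primaryComponent Wd.sha 2) ∧
      0 < Nat.card (AddCommGroup.primaryComponent (W.baseChange K).sha 2) ∧ ∃ q : ℚ, q ≠ 0 ∧
      (q : ℝ) = (W.regulator * W.bsdPeriod * ((W.modifiedTamagawaProduct : ℚ) : ℝ) /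
        ((W.torsionOrder : ℕ) : ℝ) ^ 2) * (Wd.regulator * Wd.bsdPeriod *
        ((Wd.modifiedTamagawaProduct : ℚ) : ℝ) / ((Wd.torsionOrder : ℕ) : ℝ) ^ 2) /
        ((W.baseChange K).regulator * (W.baseChange K).bsdPeriod *
        (((W.baseChange K).modifiedTamagawaProduct : ℚ) : ℝ) /
        (((W.baseChange K).torsionOrder : ℕ) : ℝ) ^ 2) ∧
      (padicValNat 2 (Nat.card (AddCommGroup.primaryComponent (W.baseChange K).sha 2)) : ℤ) =
        (padicValNat 2 (Nat.card (AddCommGroup.primaryComponent W.sha 2)) : ℤ) + (padicValNat 2 (Nat.card (AddCommGroup.primaryComponent Wd.sha 2)) : ℤ) + padicValRat 2 q := by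
  intro W _ _ _ _hcm _hT _hΔ K _ _ hK _hodd _h3 hH _hsq _hsq2 _hsurj Dt β ι d₁ hy _M₀ _hdiv _hndiv _n _d _hn
    _hKol _hprim Wd _ _ hWd
  exact milneDefect_of_kolyvagin_of_milne W K (hKo _ W K) hMilne hK hH d₁ hy Wd hWd

end Summit.BirchSwinnertonDyer.BirchSwinnertonDyer.Theorems.GenusExact.PlusDescent

end
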